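import Summits.MatrixMultiplication.OmegaCensus.SmallFormats.MatMul22nRankGF7Slack3NoTightPoint
import Summits.MatrixMultiplication.OmegaCensus.SmallFormats.MatMul22nRankGF7TightGeneral
import HarnessLib

/-!
# ω-census family (a): the LOCAL IDENTITY of the `𝔽₇` X-cap system at EVERY slack `s` from the landed slack-3 certificates

Cell `pub-omega` (unit `pub-omega-tensor-g15`), topic `Summits/MatrixMultiplication/OmegaCensus` (sub-folder `SmallFormats`).
Framing (verbatim): lottery ticket; floor = certified bounds/negative ranges. HONEST FRAMING: kernel infrastructure (step K2 of the
kernel route for the engine-decided cells `NoTightPoint7 4 208` / `5 260` / `6 312`, `pub-omega-tensor-g14/METHOD-CONGRUENCE-g14.md §6`),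
no bound by itself; nothing here is progress on `ω`.

OBSERVATION. The 336 local-identity certificates `W_g` landed for slack `3` (`identOK7 g W_g = true`,
`MatMul22nRankGF7Slack3IdentityData1–8`, meaning `MatMul22nRankGF7Slack3Cert.ident7_of_identOK7`) are SLACK-INDEPENDENT: the check
`identOK7` mentions the slack only through the right-hand sides `rhsN7 r ∈ {3, 6}` in the constant `Σ_r (wt_r % 16)·rhsN7 r = 3654`,
and since `3·rhsN7s s r = s·rhsN7 r` row by row, the same certificate gives `Σ_r (wt_r % 16)·rhsN7s s r = 1218·s` for every `s`
(`identOK7_const_generic`). Hence (`ident7s_of_identOK7`) for every slack `s`, every invertible class `g` and every point `x`: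
`Σ_r ν_r·(xrs7 x r − rhsN7s s r) = 224·x g + 28·μ[g] − 8·Π[g] + 64·s`, and at a TIGHT point of slack `s` (tangent rows `= s`,
row-plane rows `= 2s`, passant rows `≤ s`; `tight7_of_total_ge`) the local identity `2·Π[g] = 56·x g + 7·μ[g] + 16·s` with
`Π[g] ≤ 21·s` (`local7s`), so `56·x g + 7·μ[g] ≤ 26·s`, `μ[g]` is even, `Π[g] ≡ s (mod 7)` and `Π[g] ≥ 8·s` (`local7s_conseq`);
at `s = 4`: `x g ≤ 1` and `x g = 1 → μ[g] ≤ 6` (`local7s_four`). Here `Π[g] = piW7 x W` is the sum of the 21 rows MARKED by the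
certificate; `marksOK7 g W` is the executable check that these are exactly the passant rows through `g` (`passThrough7`), under which
`piW7 x W = piTrue7 x g` (`piW7_eq_piTrue7`, `local7s_true`) — the per-class checks `marksOK7 g W_g` are sibling data files (they
re-use the landed literals `W_g` by unification; no new certificates).
-/

namespace Summit.MatrixMultiplication.OmegaCensus.SmallFormats

open Finset
open Literature.NumberTheory.NumberFields (list_sum_range_map)

/-! ## Right-hand sides at slack `s` and the generic constant -/

/-- Right-hand sides of the cap / row-plane rows at slack `s`, as naturals: `s` on the 1266 cap rows, `2s` on the 8 row-plane rows. -/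
def rhsN7s (s r : ℕ) : ℕ := if r < 1266 then s else 2 * s

/-- Row by row, `3 · rhsN7s s r = s · rhsN7 r`. -/
theorem three_mul_rhsN7s (s r : ℕ) : 3 * rhsN7s s r = s * rhsN7 r := by
  unfold rhsN7s rhsN7; split_ifs <;> ring

/-- At `s = 3` the generic right-hand sides are the slack-3 ones. -/
theorem rhsN7s_three (r : ℕ) : rhsN7s 3 r = rhsN7 r := by
  unfold rhsN7s rhsN7; split_ifs <;> rfl

/-- `Σ_{r<1274} rhsN7s s r = 1282·s`. -/
theorem sum_rhsN7s (s : ℕ) : ∑ r ∈ range 1274, (rhsN7s s r : ℤ) = 1282 * s := by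
  rw [show (1274 : ℕ) = 1266 + 8 from rfl, sum_range_add]
  have a : ∑ r ∈ range 1266, (rhsN7s s r : ℤ) = ∑ r ∈ range 1266, (s : ℤ) :=
    sum_congr rfl fun r hr => by unfold rhsN7s; rw [if_pos (mem_range.1 hr)]
  have b : ∑ k ∈ range 8, (rhsN7s s (1266 + k) : ℤ) = ∑ k ∈ range 8, (2 * (s : ℤ)) :=
    sum_congr rfl fun k _ => by unfold rhsN7s; rw [if_neg (by omega)]; push_cast; ring
  rw [a, b, sum_const, sum_const, card_range, card_range, nsmul_eq_mul, nsmul_eq_mul]; push_cast; ring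

/-- **Generic constant.** A passing slack-3 certificate has `Σ_r (wt_r % 16)·rhsN7s s r = 1218·s` for every slack `s`. -/
theorem identOK7_const_generic {g W : ℕ} (h : identOK7 g W = true) (s : ℕ) :
    ∑ r ∈ range 1274, ((wt7 W r % 16 : ℕ) : ℤ) * (rhsN7s s r : ℤ) = 1218 * s := by
  unfold identOK7 at h
  simp only [Bool.and_eq_true, beq_iff_eq] at h
  obtain ⟨⟨⟨⟨_, hconst⟩, _⟩, _⟩, _⟩ := h
  rw [list_sum_range_map] at hconst
  have h2 : ∑ r ∈ range 1274, ((wt7 W r % 16 : ℕ) : ℤ) * (rhsN7 r : ℤ) = 3654 := by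
    have h0 : ((∑ r ∈ range 1274, wt7 W r % 16 * rhsN7 r : ℕ) : ℤ) = (3654 : ℕ) := by rw [hconst]
    push_cast at h0
    exact h0
  have h3 : (3 : ℤ) * ∑ r ∈ range 1274, ((wt7 W r % 16 : ℕ) : ℤ) * (rhsN7s s r : ℤ)
      = (s : ℤ) * ∑ r ∈ range 1274, ((wt7 W r % 16 : ℕ) : ℤ) * (rhsN7 r : ℤ) := by
    rw [mul_sum, mul_sum]
    refine sum_congr rfl fun r _ => ?_
    have e : (3 : ℤ) * (rhsN7s s r : ℤ) = (s : ℤ) * (rhsN7 r : ℤ) := by exact_mod_cast three_mul_rhsN7s s r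
    calc (3 : ℤ) * (((wt7 W r % 16 : ℕ) : ℤ) * (rhsN7s s r : ℤ))
        = ((wt7 W r % 16 : ℕ) : ℤ) * ((3 : ℤ) * (rhsN7s s r : ℤ)) := by ring
      _ = ((wt7 W r % 16 : ℕ) : ℤ) * ((s : ℤ) * (rhsN7 r : ℤ)) := by rw [e]
      _ = (s : ℤ) * (((wt7 W r % 16 : ℕ) : ℤ) * (rhsN7 r : ℤ)) := by ring
  rw [h2] at h3
  linarith

/-! ## The identity at slack `s` -/

/-- **Local identity at every slack.** For a passing certificate at `g` and every point `x`:
`Σ_r ν_r·(xrs7 x r − rhsN7s s r) = 224·x g + 28·μ[g] − 8·Π[g] + 64·s`. -/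
theorem ident7s_of_identOK7 {g W : ℕ} (hg : g < 400) (h : identOK7 g W = true) (s : ℕ) (x : ℕ → ℕ) :
    ∑ r ∈ range 1274, nuW7 W r * (xrs7 x r - (rhsN7s s r : ℤ))
      = 224 * (x g : ℤ) + 28 * muTr7 x g - 8 * piW7 x W + 64 * s := by
  have h3 := ident7_of_identOK7 hg h x
  have hcs : ∀ t : ℕ, ∑ r ∈ range 1274, nuW7 W r * (rhsN7s t r : ℤ) = -(64 * (t : ℤ)) := by
    intro t
    have e : ∀ r ∈ range 1274, nuW7 W r * (rhsN7s t r : ℤ)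
        = ((wt7 W r % 16 : ℕ) : ℤ) * (rhsN7s t r : ℤ) - (rhsN7s t r : ℤ) := by
      intro r _; unfold nuW7; ring
    rw [sum_congr rfl e, sum_sub_distrib, identOK7_const_generic h t, sum_rhsN7s]; ring
  have hc3 : ∑ r ∈ range 1274, nuW7 W r * (rhsN7 r : ℤ) = -192 := by
    have e : ∀ r ∈ range 1274, nuW7 W r * (rhsN7 r : ℤ) = nuW7 W r * (rhsN7s 3 r : ℤ) := by
      intro r _; rw [rhsN7s_three]
    rw [sum_congr rfl e, hcs 3]; norm_num
  have eL : ∀ t : ℕ → ℤ, ∑ r ∈ range 1274, nuW7 W r * (xrs7 x r - t r)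
      = ∑ r ∈ range 1274, nuW7 W r * xrs7 x r - ∑ r ∈ range 1274, nuW7 W r * t r := by
    intro t; rw [← sum_sub_distrib]; exact sum_congr rfl fun r _ => by ring
  rw [eL] at h3 ⊢
  rw [hc3] at h3
  rw [hcs s]
  linarith

/-- **Local step at a tight point of slack `s`.** The identity at `g` with tangent rows `= s`, row-plane rows `= 2s` and the
21 marked passant caps `≤ s`: `2·Π[g] = 56·x g + 7·μ[g] + 16·s` and `Π[g] ≤ 21·s`. -/
theorem local7s {s g W : ℕ} (hg : g < 400) (hW : identOK7 g W = true) (x : ℕ → ℕ)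
    (hT : ∀ r < 384, xrs7 x r = s) (hR : ∀ k < 8, xrs7 x (1266 + k) = 2 * (s : ℤ))
    (hP : ∀ r, 384 ≤ r → r < 1266 → xrs7 x r ≤ s) :
    2 * piW7 x W = 56 * (x g : ℤ) + 7 * muTr7 x g + 16 * s ∧ piW7 x W ≤ 21 * s := by
  have hid := ident7s_of_identOK7 hg hW s x
  have hzero : ∑ r ∈ range 1274, nuW7 W r * (xrs7 x r - (rhsN7s s r : ℤ)) = 0 := by
    refine sum_eq_zero fun r hr => ?_
    have hr' := mem_range.1 hr
    by_cases h384 : r < 384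
    · have e : (rhsN7s s r : ℤ) = s := by unfold rhsN7s; rw [if_pos (by omega)]
      rw [hT r h384, e]; ring
    by_cases h1266 : r < 1266
    · rw [nuW7_passant_of_identOK7 hW (by omega) h1266, zero_mul]
    · obtain ⟨k, hk, rfl⟩ : ∃ k < 8, r = 1266 + k := ⟨r - 1266, by omega, by omega⟩
      have e : (rhsN7s s (1266 + k) : ℤ) = 2 * (s : ℤ) := by
        unfold rhsN7s; rw [if_neg (by omega)]; push_cast; ring
      rw [hR k hk, e]; ring
  have hPi : piW7 x W ≤ 21 * s := by
    unfold piW7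
    have hle : ∀ r ∈ range 1274, (mark7 W r : ℤ) * xrs7 x r ≤ (mark7 W r : ℤ) * s := by
      intro r hr
      by_cases hm : mark7 W r = 0
      · rw [hm]; simp
      · obtain ⟨h1, h2⟩ := marks7_range_of_identOK7 hW (mem_range.1 hr) hm
        have := mark7_le_one W r
        have h3 := hP r h1 h2
        have hm1 : mark7 W r = 1 := by omega
        rw [hm1]; push_cast; linarith
    have hs := marks7_sum_of_identOK7 hW
    have h21 : ∑ r ∈ range 1274, (mark7 W r : ℤ) * s = 21 * s := by rw [← sum_mul, hs]
    linarith [sum_le_sum hle, h21]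
  rw [hzero] at hid
  constructor <;> linarith

/-- **Consequences at a tight point of slack `s`:** `56·x g + 7·μ[g] ≤ 26·s`, `μ[g]` even, `Π[g] ≡ s (mod 7)`, `Π[g] ≥ 8·s`. -/
theorem local7s_conseq {s g W : ℕ} (hg : g < 400) (hW : identOK7 g W = true) (x : ℕ → ℕ)
    (hT : ∀ r < 384, xrs7 x r = s) (hR : ∀ k < 8, xrs7 x (1266 + k) = 2 * (s : ℤ))
    (hP : ∀ r, 384 ≤ r → r < 1266 → xrs7 x r ≤ s) :
    56 * (x g : ℤ) + 7 * muTr7 x g ≤ 26 * s ∧ muTr7 x g % 2 = 0 ∧ piW7 x W % 7 = (s : ℤ) % 7 ∧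
      8 * (s : ℤ) ≤ piW7 x W := by
  obtain ⟨h1, h2⟩ := local7s hg hW x hT hR hP
  have hmu0 : 0 ≤ muTr7 x g := sum_nonneg fun i _ => Int.natCast_nonneg _
  have hx0 : (0 : ℤ) ≤ x g := Int.natCast_nonneg _
  refine ⟨by linarith, ?_, ?_, by linarith⟩ <;> omega

/-- **Slack `4`.** At a tight point of slack `4`: `x g ≤ 1`, `x g = 1 → μ[g] ≤ 6`, and `μ[g] ≤ 14`. -/
theorem local7s_four {g W : ℕ} (hg : g < 400) (hW : identOK7 g W = true) (x : ℕ → ℕ)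
    (hT : ∀ r < 384, xrs7 x r = 4) (hR : ∀ k < 8, xrs7 x (1266 + k) = 2 * (4 : ℤ))
    (hP : ∀ r, 384 ≤ r → r < 1266 → xrs7 x r ≤ 4) :
    x g ≤ 1 ∧ (x g = 1 → muTr7 x g ≤ 6) ∧ muTr7 x g ≤ 14 := by
  have hT' : ∀ r < 384, xrs7 x r = ((4 : ℕ) : ℤ) := fun r hr => by rw [hT r hr]; rfl
  have hR' : ∀ k < 8, xrs7 x (1266 + k) = 2 * ((4 : ℕ) : ℤ) := fun k hk => by rw [hR k hk]; rfl
  have hP' : ∀ r, 384 ≤ r → r < 1266 → xrs7 x r ≤ ((4 : ℕ) : ℤ) := fun r h1 h2 => by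
    have := hP r h1 h2; exact_mod_cast this
  obtain ⟨h1, h2, _, _⟩ := local7s_conseq (s := 4) hg hW x hT' hR' hP'
  have hmu0 : 0 ≤ muTr7 x g := sum_nonneg fun i _ => Int.natCast_nonneg _
  push_cast at h1
  refine ⟨?_, ?_, ?_⟩
  · have : (x g : ℤ) ≤ 1 := by omega
    exact_mod_cast this
  · intro hx; rw [hx] at h1; push_cast at h1; omega
  · omega

/-! ## The marked rows are the passant rows through `g` -/

/-- Row `r` is a passant row (`384 ≤ r < 1266`) listing the class `g`. -/
def passThrough7 (g r : ℕ) : Bool := decide (384 ≤ r) && decide (r < 1266) && (rowList7 r).elem g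

/-- **Executable check:** the rows marked by the certificate `W` are exactly the passant rows through `g`. -/
def marksOK7 (g W : ℕ) : Bool := (List.range 1274).all fun r => (mark7 W r == 1) == passThrough7 g r

/-- `Π[g]` proper: the point summed over the passant rows through `g` (the 21 torus cosets containing `g`). -/
def piTrue7 (x : ℕ → ℕ) (g : ℕ) : ℤ := ∑ r ∈ range 1274, if passThrough7 g r = true then xrs7 x r else 0

/-- Under `marksOK7`, the certificate's marked sum is `Π[g]` proper. -/
theorem piW7_eq_piTrue7 {g W : ℕ} (h : marksOK7 g W = true) (x : ℕ → ℕ) : piW7 x W = piTrue7 x g := by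
  unfold piW7 piTrue7
  refine sum_congr rfl fun r hr => ?_
  unfold marksOK7 at h
  have hr' := List.all_eq_true.1 h r (List.mem_range.2 (mem_range.1 hr))
  have hle := mark7_le_one W r
  by_cases hp : passThrough7 g r = true
  · rw [if_pos hp]
    rw [hp] at hr'
    have : mark7 W r = 1 := by simpa using hr'
    rw [this]; push_cast; ring
  · rw [if_neg hp]
    have hp' : passThrough7 g r = false := by simpa using hp
    rw [hp'] at hr'
    have : mark7 W r ≠ 1 := by simpa using hr'
    have h0 : mark7 W r = 0 := by omega
    rw [h0]; simp

/-- **Local identity with `Π[g]` proper,** given both checks. -/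
theorem local7s_true {s g W : ℕ} (hg : g < 400) (hW : identOK7 g W = true) (hM : marksOK7 g W = true) (x : ℕ → ℕ)
    (hT : ∀ r < 384, xrs7 x r = s) (hR : ∀ k < 8, xrs7 x (1266 + k) = 2 * (s : ℤ))
    (hP : ∀ r, 384 ≤ r → r < 1266 → xrs7 x r ≤ s) :
    2 * piTrue7 x g = 56 * (x g : ℤ) + 7 * muTr7 x g + 16 * s ∧ piTrue7 x g ≤ 21 * s ∧
      piTrue7 x g % 7 = (s : ℤ) % 7 ∧ 8 * (s : ℤ) ≤ piTrue7 x g := by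
  obtain ⟨h1, h2⟩ := local7s hg hW x hT hR hP
  obtain ⟨_, _, h3, h4⟩ := local7s_conseq hg hW x hT hR hP
  rw [piW7_eq_piTrue7 hM] at h1 h2 h3 h4
  exact ⟨h1, h2, h3, h4⟩

end Summit.MatrixMultiplication.OmegaCensus.SmallFormats
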